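import Mathlib
import Summits.AnomalousDissipation.AnomalousDissipation.Theses.TaylorCertificates
import Literature.Analysis.FluidPDE.StatisticalSolution
import Literature.Analysis.FluidPDE.StokesTorus

/-!
# Sketch — crux-ideate stmt-AnomalousDissipation-14086 (FloorCertificateEnsembleCeiling), round 1, ideator 1

First lemmas of the two idea cards (signatures must elaborate; proofs are not required here):

* card `cubic-budget-certificate`: `CubicCertificate`, `cubicCertificate_floor` (proved),
  `ensembleEnergy_le_of_cubicFloor` (weak duality with a state-dependent budget; sorried, M-sized),
  `x_of_cubicCertificate` (proved from the two), `UniformBeta`, `x_ensemble_of_uniformBeta` (sorried, S-sized).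
* card `cyclic-livsic-moats`: `gpForce`, `gp_transverse_energy_floor` (sorried, M-sized: one linear
  Liouville test + Cauchy–Schwarz), `gp_moat` (corollary form).
-/

noncomputable section

open MeasureTheory Filter Topology
open scoped InnerProductSpace ENNReal

namespace Summit.AnomalousDissipation.AnomalousDissipation.Cruxes.FloorCertificateEnsembleCeiling.Ideator1

open Literature.Analysis.FunctionSpaces Literature.Analysis.FluidPDE
open Summit.AnomalousDissipation.AnomalousDissipation.Theses.TaylorCertificates

local notation "𝕋³" => UnitAddTorus (Fin 3)
local notation "E³" => EuclideanSpace ℝ (Fin 3)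
local notation "L2" => MeasureTheory.Lp (EuclideanSpace ℝ (Fin 3)) 2 (MeasureTheory.volume : MeasureTheory.Measure (UnitAddTorus (Fin 3)))
local notation "H3" => Torus.energySpace (Fin 3)

/-! ## Card 1 — the cubic-budget certificate -/

/-- The FLOOR inequality of `X` at one state, with a STATE-DEPENDENT budget `g u` in place of `ε₀`
(verbatim the inner block of `FloorCertificateEnsembleCeiling` otherwise). -/
def FloorIneqWith (ν : ℝ) (f : 𝕋³ → E³) (Φ₁ : Torus.CylindricalTest (Fin 3)) (θ₁ : ℝ)
    (g : H3 → ℝ) (u : H3) : Prop :=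
  let uf : 𝕋³ → E³ := ((u : L2) : 𝕋³ → E³)
  let D : ℝ := ν * (Torus.eGradNormSq uf).toReal
  let P : ℝ := Torus.pairing (u : L2) f - D
  Torus.eGradNormSq uf ≠ ⊤ → ‖u‖ ^ 2 ≤ 16 * (∫ x, ‖f x‖ ^ 2) / ν ^ 2 →
    g u ≤ D + Torus.nsGeneratorPairing ν f u (Φ₁.grad u) + 2 * θ₁ * P

/-- **CubicCertificate** (`C⁺` of card `cubic-budget-certificate`): ONE force and ONE `X`-class
certificate per `ν` (cylindrical `Φ₁`, constant weight `θ₁ ≤ 0`) whose budget is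
`max ε₀ (β |u|³)` — Kolmogorov's scale-free floor — on the finite-enstrophy Leray ball. -/
def CubicCertificate : Prop :=
  ∃ f : 𝕋³ → E³, Torus.IsSmooth f ∧ Torus.IsDivFree f ∧ Torus.HasZeroMean f ∧
    ∃ (ε₀ β ν₀ : ℝ), 0 < ε₀ ∧ 0 < β ∧ 0 < ν₀ ∧ ∀ ν : ℝ, 0 < ν → ν < ν₀ →
      ∃ (Φ₁ : Torus.CylindricalTest (Fin 3)) (θ₁ : ℝ), θ₁ ≤ 0 ∧
        ∀ u : H3, FloorIneqWith ν f Φ₁ θ₁ (fun v => max ε₀ (β * ‖v‖ ^ 3)) u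

/-- The floor half is immediate: a cubic budget dominates the constant budget `ε₀`. -/
theorem floorIneqWith_mono {ν : ℝ} {f : 𝕋³ → E³} {Φ₁ : Torus.CylindricalTest (Fin 3)} {θ₁ : ℝ}
    {g g' : H3 → ℝ} (hle : ∀ u, g' u ≤ g u) {u : H3} (h : FloorIneqWith ν f Φ₁ θ₁ g u) :
    FloorIneqWith ν f Φ₁ θ₁ g' u := by
  intro hfin hball
  exact (hle u).trans (h hfin hball)

/-- **Weak duality with a state-dependent budget** (the `g`-version of the landed
`Theorems/FloorCertificate/Negative/WeakDuality`): if `g ≤ D + ⟨F,Φ₁'⟩ + 2θ₁P` on the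
finite-enstrophy Leray ball with `θ₁ ≤ 0`, then every stationary statistical solution of `NS_ν(f)`
with integrable energy has `∫ g dμ ≤ ε(μ)`; with `g = max ε₀ (β|u|³)`, Jensen and
`ε(μ) ≤ ‖f‖ U` (`ensembleDissipation_le_of_isStationary_holds`) give the ENSEMBLE CEILING
`U² ≤ ‖f‖/β`. M-sized; not proved here. -/
theorem ensembleEnergy_le_of_cubicFloor {ν ε₀ β : ℝ} (hν : 0 < ν) (hβ : 0 < β) {f : 𝕋³ → E³}
    (hf : Torus.IsSmooth f) {Φ₁ : Torus.CylindricalTest (Fin 3)} {θ₁ : ℝ} (hθ : θ₁ ≤ 0)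
    (hfloor : ∀ u : H3, FloorIneqWith ν f Φ₁ θ₁ (fun v => max ε₀ (β * ‖v‖ ^ 3)) u)
    {μ : Measure H3} (hμ : Torus.IsStationaryStatisticalSolution ν f μ)
    (hint : Integrable (fun v : H3 => ‖v‖ ^ 2) μ) :
    Torus.ensembleEnergy μ ≤ Real.sqrt (∫ x, ‖f x‖ ^ 2) / β := by
  sorry

/-- **First lemma of card 1**: `CubicCertificate → X` (both halves, same force, same certificate). -/
theorem x_of_cubicCertificate (h : CubicCertificate) : FloorCertificateEnsembleCeiling := by
  obtain ⟨f, hfs, hfd, hfz, ε₀, β, ν₀, hε₀, hβ, hν₀, hcert⟩ := h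
  refine ⟨f, hfs, hfd, hfz, ε₀, Real.sqrt (∫ x, ‖f x‖ ^ 2) / β, ν₀, hε₀, hν₀, fun ν hν hνlt => ?_⟩
  obtain ⟨Φ₁, θ₁, hθ₁, hfloor⟩ := hcert ν hν hνlt
  refine ⟨⟨Φ₁, θ₁, hθ₁, fun u => ?_⟩, fun μ hμ hint => ?_⟩
  · exact floorIneqWith_mono (g := fun v => max ε₀ (β * ‖v‖ ^ 3)) (fun v => le_max_left _ _) (hfloor u)
  · exact ensembleEnergy_le_of_cubicFloor hν hβ hfs hθ₁ hfloor hμ hint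

/-- **UniformBeta** (the ensemble form, NECESSARY for `X` with `β₀ = ε₀ / E^{3/2}`): Kolmogorov's
number `β(μ) = ε(μ)/U(μ)³` is bounded below over all stationary statistics of one force, uniformly
in `ν`. Invariant under the exact amplitude scaling `(u, ν, f) ↦ (u/A, ν/A, f/A²)` of the tree's
predicate (`ScalingCovariance`, Cruxes/EnsembleCeiling triage r1-3). -/
def UniformBeta : Prop :=
  ∃ f : 𝕋³ → E³, Torus.IsSmooth f ∧ Torus.IsDivFree f ∧ Torus.HasZeroMean f ∧ 0 < (∫ x, ‖f x‖ ^ 2) ∧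
    ∃ (β₀ ν₀ : ℝ), 0 < β₀ ∧ 0 < ν₀ ∧ ∀ ν : ℝ, 0 < ν → ν < ν₀ →
      ∀ μ : Measure H3, Torus.IsStationaryStatisticalSolution ν f μ →
        Integrable (fun v : H3 => ‖v‖ ^ 2) μ →
          β₀ * (Torus.ensembleEnergy μ) ^ (3 / 2 : ℝ) ≤ Torus.ensembleDissipation ν μ

/-- `X ⇒ UniformBeta` on the weak-duality side (floor ⇒ `ε ≥ ε₀`, ceiling ⇒ `U² ≤ E`,
so `β ≥ ε₀/E^{3/2}`), and conversely `UniformBeta ⇒` ensemble floor `ε ≥ β₀ c_f³` (linear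
Liouville test with `g = f`: `‖f‖² ≤ ν U ‖Af‖ + ‖∇f‖_∞ U²`) and ceiling `U² ≤ ‖f‖/β₀`
(`ε ≤ ‖f‖ U`). S-sized each; the ensemble-floor-to-certificate step is the FloorMinimax line of
crux FloorCertificate. Stated here as the ceiling direction only. -/
theorem ensembleCeiling_of_uniformBeta (h : UniformBeta) :
    ∃ f : 𝕋³ → E³, Torus.IsSmooth f ∧ Torus.IsDivFree f ∧ Torus.HasZeroMean f ∧ 0 < (∫ x, ‖f x‖ ^ 2) ∧
      ∃ (E ν₀ : ℝ), 0 < ν₀ ∧ ∀ ν : ℝ, 0 < ν → ν < ν₀ →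
        ∀ μ : Measure H3, Torus.IsStationaryStatisticalSolution ν f μ →
          Integrable (fun v : H3 => ‖v‖ ^ 2) μ → Torus.ensembleEnergy μ ≤ E := by
  sorry

/-! ## Card 2 — cyclic Livšic moats for the Gromeka–Pelz / cyclic Kolmogorov triple -/

/-- A real sine Stokes mode `x ↦ sin(2π x_i) e_j` on `T³`. -/
def sinMode (i j : Fin 3) : 𝕋³ → E³ :=
  fun x => Torus.stokesMode (d := Fin 3) (Pi.single i 1) (EuclideanSpace.single j 1) false x

/-- The cyclic Kolmogorov triple `f_GP = (sin 2πz, sin 2πx, sin 2πy)` =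
`sin(2πx₂)e₀ + sin(2πx₀)e₁ + sin(2πx₁)e₂` (route FrustratedForces' `f_GP`). -/
def gpForce : 𝕋³ → E³ := fun x => sinMode 2 0 x + sinMode 0 1 x + sinMode 1 2 x

/-- **First lemma of card 2 (transverse-energy floor = moat around the `e₀`-jet family).**
For every `ν > 0` and EVERY stationary statistical solution `μ` of `NS_ν(f_GP)` with integrable
energy: testing Liouville with the linear functional `u ↦ (u, k)`, `k = 2 sin(2πx₁) e₂` (twice the
third force mode; `(f_GP,k) = 1`, `Ak = 4π²k`, and `∫(u·∇k)·u = 4π ∫ u₁ u₂ cos(2πx₁)` involves only the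
components transverse to `e₀`) gives `1 = 8π²ν ∫(u, sin(2πx₁)e₂)dμ − 4π ∫∫ u₁u₂cos(2πx₁) dμ`, hence
`1 ≤ 2π ∫ ‖(u₁,u₂)‖² dμ + 8π²ν ∫ (u, sin(2πx₁)e₂) dμ`. The right-hand integrand of the first term is
`dist(u, W₀)²`-dominated for the steady-Euler jet family `W₀ = {S(x₁,x₂) e₀}`. M-sized. -/
theorem gp_transverse_energy_floor {ν : ℝ} (hν : 0 < ν) {μ : Measure H3}
    (hμ : Torus.IsStationaryStatisticalSolution ν gpForce μ)
    (hint : Integrable (fun v : H3 => ‖v‖ ^ 2) μ) :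
    1 ≤ 2 * Real.pi * ∫ u, (∫ x, (inner ℝ (((u : L2) : 𝕋³ → E³) x) (EuclideanSpace.single 1 1)) ^ 2
              + (inner ℝ (((u : L2) : 𝕋³ → E³) x) (EuclideanSpace.single 2 1)) ^ 2) ∂μ
        + 8 * Real.pi ^ 2 * ν * ∫ u, Torus.pairing (u : L2) (sinMode 1 2) ∂μ := by
  sorry

/-- **Moat corollary**: the mean-square `H`-distance of any stationary statistic of `f_GP` from the
whole infinite-dimensional steady-Euler family `W₀ = {S(x₁,x₂)e₀}` (all profiles, all amplitudes) is
at least `(1 − 8π²ν a₂)/(2π)`, `a₂ = ∫(u, sin(2πx₁)e₂)dμ ≤ U/√2`; by the cyclic bootstrap (a jet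
family can only be hugged if the NEXT force mode carries half-laminar mean amplitude, which the
next moat forbids) the bound is `≥ 1/(2π) − O(ν)` absolutely. Stated for one `V ∈ W₀` given as an
`H`-state whose transverse components vanish a.e. -/
theorem gp_moat {ν : ℝ} (hν : 0 < ν) {μ : Measure H3}
    (hμ : Torus.IsStationaryStatisticalSolution ν gpForce μ)
    (hint : Integrable (fun v : H3 => ‖v‖ ^ 2) μ)
    (V : H3) (hV : ∀ᵐ x ∂(volume : Measure 𝕋³),
      inner ℝ (((V : L2) : 𝕋³ → E³) x) (EuclideanSpace.single 1 1) = 0 ∧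
      inner ℝ (((V : L2) : 𝕋³ → E³) x) (EuclideanSpace.single 2 1) = 0) :
    1 - 8 * Real.pi ^ 2 * ν * ∫ u, Torus.pairing (u : L2) (sinMode 1 2) ∂μ
      ≤ 2 * Real.pi * ∫ u, ‖u - V‖ ^ 2 ∂μ := by
  sorry

end Summit.AnomalousDissipation.AnomalousDissipation.Cruxes.FloorCertificateEnsembleCeiling.Ideator1

end
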